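import Summits.KontsevichZagierPeriods.KontsevichZagierPeriods.Theorems.MzvKernelInKZ.Negative.Core
import Literature.NumberTheory.Transcendental.MZVWordShuffle

/-!
# `MzvKernelInKZ`, line two-posets-interior-landen: shuffle cells of a product of simplices

Auxiliary file of the stub `stub_shuffleProduct` (crux `LinRedNormalForm.MzvKernelInKZ`,
stmt-KontsevichZagierPeriods-3914; main file `MzvKernelInKZTwoPosetsShuffleProduct.lean`).

The product `Δ_a × Δ_b ⊆ ℝ^{a+b}` of two open ordered simplices (first `a` coordinates
`x₀ > ⋯ > x_{a-1}`, last `b` coordinates `y₀ > ⋯ > y_{b-1}`, all in `(0,1)`) is, off the null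
walls `{xᵢ = yⱼ}`, the disjoint union of the SHUFFLE CELLS `{z | z ∘ e ∈ Δ_{a+b}}`, one for each
sorting permutation `e` of `Fin (a + b)` whose label list `ofFn e` is an interleaving of the two
label lists `castAdd b 0, …, castAdd b (a-1)` and `natAdd a 0, …, natAdd a (b-1)`.  We index the
interleavings by the tree's recursive shuffle product `MZV.shuffleWord` of the label lists, whose
image under the letters `Fin.append ε ε'` is `MZV.shuffleWord (ofFn ε) (ofFn ε')`
(`shuffleWord_map`).  No definitions are introduced.  Contents:

* list combinatorics of `MZV.shuffleWord`: naturality, both factors are sublists of every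
  interleaving, every interleaving is a permutation of the concatenation, interleavings of
  duplicate-free disjoint lists are pairwise distinct, and the merging lemma: two strictly sorted
  lists without ties have a strictly sorted interleaving (`exists_pairwise_mem_shuffleWord`,
  registered form `stub_shuffleProductMerge`);
* sorting permutations: `z ∘ e ∈ Δ_n` iff all coordinates lie in `(0,1)` and `ofFn e` is sorted by
  decreasing value (`comp_mem_simplex_iff`); distinct label lists have disjoint cells
  (`ofFn_eq_of_comp_mem_simplex`); the walls `{zᵢ = zⱼ}` are null (`volume_setOf_apply_eq_apply`);
* coordinate shuffles: they are enumerated bijectively by finitely many sorting permutations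
  (`exists_enum_coordShuffles`), their cells lie in `Δ_a × Δ_b` (`mem_simplex_of_comp_mem_simplex`)
  and cover it off the walls (`exists_comp_mem_simplex`);
* on a cell the product integrand `ω_ε(x) ω_{ε'}(y)` is the word integrand of the merged word
  `Fin.append ε ε' ∘ e` read along `e` (`wordFun_append_comp_equiv`), and the merged word is
  admissible when `ε`, `ε'` are admissible and non-empty (`adm_append_comp_equiv`).

References: M. Kontsevich, D. Zagier, *Periods* (2001), §1.2 (rules (1), (2)); M. Eie, *The
Theory of Multiple Zeta Values with Applications in Combinatorics* (2013), §1.2 (the shuffle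
product formula as a decomposition of `Δ_a × Δ_b`); C. Reutenauer, *Free Lie Algebras* (1993),
§1.4 (the recursion of `ш`).
-/

noncomputable section

namespace Summit.KontsevichZagierPeriods.MzvKernelInKZ.TwoPosets

open Set MeasureTheory
open Literature.NumberTheory.Transcendental
open Summit.KontsevichZagierPeriods.MzvKernelInKZ.Negative

/-! ## List combinatorics of the shuffle product -/

section Lists

variable {α β : Type*}

/-- Naturality of the shuffle product under a relabelling of the letters:
`(map f u) ш (map f v) = map (map f) (u ш v)`. [folklore] -/
theorem shuffleWord_map (f : α → β) : ∀ (u v : List α),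
    MZV.shuffleWord (u.map f) (v.map f) = (MZV.shuffleWord u v).map (List.map f)
  | [], v => by simp
  | a :: u, [] => by simp
  | a :: u, b :: v => by
    have h₁ := shuffleWord_map f u (b :: v)
    have h₂ := shuffleWord_map f (a :: u) v
    simp only [List.map_cons] at h₁ h₂ ⊢
    rw [MZV.shuffleWord_cons_cons, MZV.shuffleWord_cons_cons, h₁, h₂]
    simp only [List.map_append, List.map_map, Function.comp_def, List.map_cons]

/-- Both factors are sublists of each of their interleavings. [folklore] -/
theorem sublist_of_mem_shuffleWord : ∀ (u v : List α) {w : List α}, w ∈ MZV.shuffleWord u v →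
    u.Sublist w ∧ v.Sublist w
  | [], v, w, hw => by
    simp only [MZV.shuffleWord_nil_left, List.mem_singleton] at hw
    subst hw
    exact ⟨List.nil_sublist _, List.Sublist.refl _⟩
  | a :: u, [], w, hw => by
    simp only [MZV.shuffleWord_nil_right, List.mem_singleton] at hw
    subst hw
    exact ⟨List.Sublist.refl _, List.nil_sublist _⟩
  | a :: u, b :: v, w, hw => by
    simp only [MZV.shuffleWord_cons_cons, List.mem_append, List.mem_map] at hw
    rcases hw with ⟨w', hw', rfl⟩ | ⟨w', hw', rfl⟩
    · have ih := sublist_of_mem_shuffleWord u (b :: v) hw'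
      exact ⟨ih.1.cons_cons a, ih.2.cons a⟩
    · have ih := sublist_of_mem_shuffleWord (a :: u) v hw'
      exact ⟨ih.1.cons b, ih.2.cons_cons b⟩

/-- Each interleaving of `u` and `v` is a permutation of `u ++ v`. [folklore] -/
theorem perm_of_mem_shuffleWord : ∀ (u v : List α) {w : List α}, w ∈ MZV.shuffleWord u v →
    w.Perm (u ++ v)
  | [], v, w, hw => by
    simp only [MZV.shuffleWord_nil_left, List.mem_singleton] at hw
    subst hw
    exact List.Perm.refl _
  | a :: u, [], w, hw => by
    simp only [MZV.shuffleWord_nil_right, List.mem_singleton] at hw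
    subst hw
    rw [List.append_nil]
  | a :: u, b :: v, w, hw => by
    simp only [MZV.shuffleWord_cons_cons, List.mem_append, List.mem_map] at hw
    rcases hw with ⟨w', hw', rfl⟩ | ⟨w', hw', rfl⟩
    · exact (perm_of_mem_shuffleWord u (b :: v) hw').cons a
    · exact ((perm_of_mem_shuffleWord (a :: u) v hw').cons b).trans List.perm_middle.symm

/-- The interleavings of two lists without repeated or common letters are pairwise distinct (as a
list, `u ш v` has no duplicates). [folklore] -/
theorem nodup_shuffleWord : ∀ (u v : List α), (u ++ v).Nodup → (MZV.shuffleWord u v).Nodup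
  | [], v, _ => List.nodup_singleton _
  | a :: u, [], _ => by
    rw [MZV.shuffleWord_nil_right]
    exact List.nodup_singleton _
  | a :: u, b :: v, h => by
    have h' : (a :: (u ++ b :: v)).Nodup := h
    have hab : a ≠ b := fun hab =>
      (List.nodup_cons.1 h').1 (hab ▸ List.mem_append_right u List.mem_cons_self)
    have h₂ : ((a :: u) ++ v).Nodup := (List.nodup_cons.1 (List.perm_middle.nodup_iff.1 h)).2
    rw [MZV.shuffleWord_cons_cons, List.nodup_append]
    refine ⟨(nodup_shuffleWord u (b :: v) (List.nodup_cons.1 h').2).map List.cons_injective,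
      (nodup_shuffleWord (a :: u) v h₂).map List.cons_injective, fun x hx y hy hxy => ?_⟩
    obtain ⟨x', -, rfl⟩ := List.mem_map.1 hx
    obtain ⟨y', -, rfl⟩ := List.mem_map.1 hy
    exact hab (List.head_eq_of_cons_eq hxy)

/-- **Merging lemma.** If `u` and `v` are strictly sorted (values `z` strictly decreasing) and no
value of `u` ties with a value of `v`, some interleaving of `u` and `v` is strictly sorted.
[folklore] -/
theorem exists_pairwise_mem_shuffleWord {γ : Type*} (z : γ → ℝ) : ∀ (u v : List γ),
    u.Pairwise (fun m m' => z m' < z m) → v.Pairwise (fun m m' => z m' < z m) →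
    (∀ m ∈ u, ∀ m' ∈ v, z m ≠ z m') →
    ∃ w ∈ MZV.shuffleWord u v, w.Pairwise (fun m m' => z m' < z m)
  | [], v, _, hv, _ => ⟨v, by simp, hv⟩
  | a :: u, [], hu, _, _ => ⟨a :: u, by simp, hu⟩
  | a :: u, b :: v, hu, hv, hne => by
    have hab : z a ≠ z b := hne a List.mem_cons_self b List.mem_cons_self
    rw [List.pairwise_cons] at hu hv
    rcases lt_or_gt_of_ne hab with h | h
    · -- `z a < z b`: the letter `b` comes first
      obtain ⟨w, hw, hs⟩ := exists_pairwise_mem_shuffleWord z (a :: u) v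
        (List.pairwise_cons.2 hu) hv.2
        fun m hm m' hm' => hne m hm m' (List.mem_cons_of_mem _ hm')
      refine ⟨b :: w, ?_, List.pairwise_cons.2 ⟨fun m hm => ?_, hs⟩⟩
      · rw [MZV.shuffleWord_cons_cons]
        exact List.mem_append_right _ (List.mem_map.2 ⟨w, hw, rfl⟩)
      · rcases List.mem_append.1 ((perm_of_mem_shuffleWord _ _ hw).mem_iff.1 hm) with hm | hm
        · rcases List.mem_cons.1 hm with rfl | hm
          · exact h
          · exact (hu.1 m hm).trans h
        · exact hv.1 m hm
    · -- `z b < z a`: the letter `a` comes first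
      obtain ⟨w, hw, hs⟩ := exists_pairwise_mem_shuffleWord z u (b :: v)
        hu.2 (List.pairwise_cons.2 hv)
        fun m hm m' hm' => hne m (List.mem_cons_of_mem _ hm) m' hm'
      refine ⟨a :: w, ?_, List.pairwise_cons.2 ⟨fun m hm => ?_, hs⟩⟩
      · rw [MZV.shuffleWord_cons_cons]
        exact List.mem_append_left _ (List.mem_map.2 ⟨w, hw, rfl⟩)
      · rcases List.mem_append.1 ((perm_of_mem_shuffleWord _ _ hw).mem_iff.1 hm) with hm | hm
        · exact hu.1 m hm
        · rcases List.mem_cons.1 hm with rfl | hm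
          · exact h
          · exact (hv.1 m hm).trans h

/-- **Merging lemma, coordinate form** (the registered principal statement of this auxiliary
file): two lists of coordinates of `ℝⁿ`, each strictly sorted by decreasing value of `z` and
without ties between them, have a strictly sorted interleaving. [folklore] -/
theorem stub_shuffleProductMerge : ∀ (n : ℕ) (z : Fin n → ℝ) (u v : List (Fin n)), u.Pairwise (fun m m' => z m' < z m) → v.Pairwise (fun m m' => z m' < z m) → (∀ m ∈ u, ∀ m' ∈ v, z m ≠ z m') → ∃ w ∈ MZV.shuffleWord u v, w.Pairwise (fun m m' => z m' < z m) :=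
  fun _ z u v => exists_pairwise_mem_shuffleWord z u v

end Lists

/-! ## Sorting permutations and the open ordered simplex -/

section Cells

variable {n : ℕ}

/-- A list enumerating `Fin n` (a permutation of `finRange n`) is the list of values of a
permutation of `Fin n`. [folklore] -/
theorem exists_equiv_of_perm_finRange {w : List (Fin n)} (hw : w.Perm (List.finRange n)) :
    ∃ e : Fin n ≃ Fin n, List.ofFn e = w := by
  have hlen : w.length = n := by rw [hw.length_eq, List.length_finRange]
  refine ⟨(finCongr hlen.symm).trans (List.Nodup.getEquivOfForallMemList w
    (hw.nodup_iff.2 (List.nodup_finRange n)) fun m => hw.mem_iff.2 (List.mem_finRange m)), ?_⟩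
  exact List.ext_getElem (by simp [hlen]) fun i h₁ h₂ => by simp

/-- The list of values of a permutation of `Fin n` is a permutation of `finRange n`. [folklore] -/
theorem ofFn_perm_finRange (e : Fin n ≃ Fin n) : (List.ofFn e).Perm (List.finRange n) := by
  rw [List.ofFn_eq_map]
  exact Equiv.Perm.map_finRange_perm e

/-- **The shuffle cell of a sorting permutation.** A tuple read along a permutation `e` of the
coordinates lies in the open ordered simplex iff all its coordinates lie in `(0,1)` and the label
list `ofFn e` is strictly sorted by decreasing value. [folklore] -/
theorem comp_mem_simplex_iff (e : Fin n ≃ Fin n) {z : Fin n → ℝ} :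
    (fun k => z (e k)) ∈ simplex n ↔
      (∀ m, 0 < z m ∧ z m < 1) ∧ (List.ofFn e).Pairwise (fun m m' => z m' < z m) := by
  rw [List.pairwise_ofFn]
  simp only [simplex, mem_setOf_eq]
  constructor
  · rintro ⟨h0, h1, h2⟩
    refine ⟨fun m => ⟨?_, ?_⟩, fun i j hij => h2 hij⟩
    · simpa using h0 (e.symm m)
    · simpa using h1 (e.symm m)
  · rintro ⟨h01, h2⟩
    exact ⟨fun k => (h01 _).1, fun k => (h01 _).2, fun i j hij => h2 hij⟩

/-- **Distinct sorting permutations have disjoint cells**: a tuple read in the simplex along two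
permutations has pairwise distinct coordinates, which are enumerated in decreasing order by
exactly one label list. [folklore] -/
theorem ofFn_eq_of_comp_mem_simplex {e₁ e₂ : Fin n ≃ Fin n} {z : Fin n → ℝ}
    (h₁ : (fun k => z (e₁ k)) ∈ simplex n) (h₂ : (fun k => z (e₂ k)) ∈ simplex n) :
    List.ofFn e₁ = List.ofFn e₂ :=
  List.Perm.eq_of_pairwise (le := fun m m' => z m' < z m)
    (fun _ _ _ _ h h' => absurd (h.trans h') (lt_irrefl _)) ((comp_mem_simplex_iff e₁).1 h₁).2
    ((comp_mem_simplex_iff e₂).1 h₂).2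
    ((ofFn_perm_finRange e₁).trans (ofFn_perm_finRange e₂).symm)

/-- A diagonal hyperplane `{y i = y j}` (`i ≠ j`) is Lebesgue-null (a proper linear subspace,
`Measure.addHaar_submodule`). [folklore] -/
theorem volume_setOf_apply_eq_apply {i j : Fin n} (hij : i ≠ j) :
    volume {y : Fin n → ℝ | y i = y j} = 0 := by
  let L : (Fin n → ℝ) →ₗ[ℝ] ℝ :=
    LinearMap.proj (R := ℝ) (φ := fun _ : Fin n => ℝ) i -
      LinearMap.proj (R := ℝ) (φ := fun _ : Fin n => ℝ) j
  have hL : ∀ y, L y = y i - y j := fun y => rfl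
  have hset : {y : Fin n → ℝ | y i = y j} = (LinearMap.ker L : Set (Fin n → ℝ)) := by
    ext y
    simp [hL, sub_eq_zero]
  rw [hset]
  refine Measure.addHaar_submodule volume (LinearMap.ker L) fun htop => ?_
  have hmem : (Pi.single i 1 : Fin n → ℝ) ∈ LinearMap.ker L := htop ▸ Submodule.mem_top
  rw [LinearMap.mem_ker, hL, Pi.single_eq_same, Pi.single_eq_of_ne hij.symm, sub_zero] at hmem
  exact one_ne_zero hmem

end Cells

/-! ## Coordinate shuffles of `ℝ^a × ℝ^b` -/

section Coord

variable {a b : ℕ}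

/-- The two label lists (first block `castAdd b`, second block `natAdd a`) concatenate to
`finRange (a + b)`. [folklore] -/
theorem ofFn_castAdd_append_ofFn_natAdd (a b : ℕ) :
    List.ofFn (Fin.castAdd b : Fin a → Fin (a + b)) ++
        List.ofFn (Fin.natAdd a : Fin b → Fin (a + b)) = List.finRange (a + b) := by
  rw [← List.ofFn_fin_append, ← List.ofFn_id]
  congr 1
  funext m
  refine Fin.addCases (fun i => ?_) (fun j => ?_) m <;> simp

/-- **Enumeration of the coordinate shuffles by sorting permutations.** The interleavings of the
two label lists (the tree's recursive `MZV.shuffleWord`, here without repetitions) are enumerated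
bijectively by a finite family of permutations of `Fin (a + b)` through `e ↦ ofFn e`. [folklore] -/
theorem exists_enum_coordShuffles (a b : ℕ) :
    ∃ (N : ℕ) (e : Fin N → (Fin (a + b) ≃ Fin (a + b))),
      (∀ i, List.ofFn (e i) ∈
        MZV.shuffleWord (List.ofFn (Fin.castAdd b : Fin a → Fin (a + b)))
          (List.ofFn (Fin.natAdd a))) ∧
      (∀ i j, List.ofFn (e i) = List.ofFn (e j) → i = j) ∧
      ∀ w ∈ MZV.shuffleWord (List.ofFn (Fin.castAdd b : Fin a → Fin (a + b)))
        (List.ofFn (Fin.natAdd a)), ∃ i, List.ofFn (e i) = w := by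
  set L := MZV.shuffleWord (List.ofFn (Fin.castAdd b : Fin a → Fin (a + b)))
    (List.ofFn (Fin.natAdd a)) with hL
  have hnd : L.Nodup :=
    nodup_shuffleWord _ _
      (by rw [ofFn_castAdd_append_ofFn_natAdd]; exact List.nodup_finRange _)
  have hperm : ∀ i : Fin L.length, (L[(i : ℕ)]).Perm (List.finRange (a + b)) := fun i =>
    ofFn_castAdd_append_ofFn_natAdd a b ▸ perm_of_mem_shuffleWord _ _ (List.getElem_mem i.2)
  choose e he using fun i : Fin L.length => exists_equiv_of_perm_finRange (hperm i)
  refine ⟨L.length, e, fun i => ?_, fun i j h => ?_, fun w hw => ?_⟩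
  · rw [he]
    exact List.getElem_mem i.2
  · rw [he, he] at h
    exact Fin.ext (hnd.getElem_inj_iff.1 h)
  · obtain ⟨i, hi, rfl⟩ := List.mem_iff_getElem.1 hw
    exact ⟨⟨i, hi⟩, he ⟨i, hi⟩⟩

/-- **Cells lie in the product of simplices**: the sub-tuples `x`, `y` of a tuple read in
decreasing order along a coordinate shuffle are strictly decreasing. [folklore] -/
theorem mem_simplex_of_comp_mem_simplex {e : Fin (a + b) ≃ Fin (a + b)}
    (he : List.ofFn e ∈ MZV.shuffleWord (List.ofFn (Fin.castAdd b : Fin a → Fin (a + b)))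
      (List.ofFn (Fin.natAdd a)))
    {z : Fin (a + b) → ℝ} (hz : (fun k => z (e k)) ∈ simplex (a + b)) :
    (fun i => z (Fin.castAdd b i)) ∈ simplex a ∧ (fun j => z (Fin.natAdd a j)) ∈ simplex b := by
  rw [comp_mem_simplex_iff] at hz
  obtain ⟨hb, hs⟩ := hz
  obtain ⟨hl, hr⟩ := sublist_of_mem_shuffleWord _ _ he
  have hl' := List.pairwise_ofFn.1 (hs.sublist hl)
  have hr' := List.pairwise_ofFn.1 (hs.sublist hr)
  exact ⟨⟨fun i => (hb _).1, fun i => (hb _).2, fun i j hij => hl' hij⟩,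
    ⟨fun j => (hb _).1, fun j => (hb _).2, fun i j hij => hr' hij⟩⟩

/-- **The cells cover the product of simplices off the walls**: if `x ∈ Δ_a`, `y ∈ Δ_b` and no
`xᵢ` equals a `yⱼ`, the merged tuple is strictly sorted along some coordinate shuffle.
[folklore] -/
theorem exists_comp_mem_simplex {z : Fin (a + b) → ℝ}
    (hx : (fun i => z (Fin.castAdd b i)) ∈ simplex a)
    (hy : (fun j => z (Fin.natAdd a j)) ∈ simplex b)
    (hne : ∀ i j, z (Fin.castAdd b i) ≠ z (Fin.natAdd a j)) :
    ∃ e : Fin (a + b) ≃ Fin (a + b),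
      List.ofFn e ∈ MZV.shuffleWord (List.ofFn (Fin.castAdd b : Fin a → Fin (a + b)))
          (List.ofFn (Fin.natAdd a)) ∧
        (fun k => z (e k)) ∈ simplex (a + b) := by
  obtain ⟨w, hw, hs⟩ := stub_shuffleProductMerge (a + b) z
    (List.ofFn (Fin.castAdd b : Fin a → Fin (a + b)))
    (List.ofFn (Fin.natAdd a : Fin b → Fin (a + b)))
    (List.pairwise_ofFn.2 fun i j hij => hx.2.2 hij)
    (List.pairwise_ofFn.2 fun i j hij => hy.2.2 hij)
    (fun m hm m' hm' => by
      obtain ⟨i, rfl⟩ := List.mem_ofFn.1 hm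
      obtain ⟨j, rfl⟩ := List.mem_ofFn.1 hm'
      exact hne i j)
  obtain ⟨e, rfl⟩ := exists_equiv_of_perm_finRange
    (ofFn_castAdd_append_ofFn_natAdd a b ▸ perm_of_mem_shuffleWord _ _ hw)
  refine ⟨e, hw, (comp_mem_simplex_iff e).2 ⟨fun m => ?_, hs⟩⟩
  refine Fin.addCases (fun i => ?_) (fun j => ?_) m
  · exact ⟨hx.1 i, hx.2.1 i⟩
  · exact ⟨hy.1 j, hy.2.1 j⟩

/-- **The product integrand on a cell is a word integrand**: reading the letters
`Fin.append ε ε'` and the coordinates along any permutation `e` of `Fin (a + b)`,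
`∏ₖ ω_{(ε,ε')(e k)}(z (e k)) = ∏ᵢ ω_{εᵢ}(xᵢ) · ∏ⱼ ω_{ε'ⱼ}(yⱼ)`. [folklore] -/
theorem wordFun_append_comp_equiv (ε : Fin a → Bool) (ε' : Fin b → Bool)
    (e : Fin (a + b) ≃ Fin (a + b)) (z : Fin (a + b) → ℝ) :
    wordFun (fun k => Fin.append ε ε' (e k)) 1 (fun k => z (e k)) =
      wordFun ε 1 (fun i => z (Fin.castAdd b i)) *
        wordFun ε' 1 (fun j => z (Fin.natAdd a j)) := by
  simp only [wordFun, Rat.cast_one, one_mul]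
  rw [Equiv.prod_comp e (fun m => if Fin.append ε ε' m then 1 / (1 - z m) else 1 / z m),
    Fin.prod_univ_add]
  simp only [Fin.append_left, Fin.append_right]

/-- **The merged word is admissible**: along a coordinate shuffle of non-empty admissible words
`ε`, `ε'`, the first letter is `ε 0` or `ε' 0` (both `0`) and the last is `ε (a-1)` or
`ε' (b-1)` (both `1`). [folklore] -/
theorem adm_append_comp_equiv {ε : Fin a → Bool} {ε' : Fin b → Bool} (hε : Adm ε)
    (hε' : Adm ε') (ha : 0 < a) (hb : 0 < b) {e : Fin (a + b) ≃ Fin (a + b)}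
    (he : List.ofFn e ∈ MZV.shuffleWord (List.ofFn (Fin.castAdd b : Fin a → Fin (a + b)))
      (List.ofFn (Fin.natAdd a))) :
    Adm (fun k => Fin.append ε ε' (e k)) := by
  intro hab
  have ha1 : a - 1 < a := Nat.sub_one_lt_of_lt ha
  have hb1 : b - 1 < b := Nat.sub_one_lt_of_lt hb
  have hab1 : a + b - 1 < a + b := Nat.sub_one_lt_of_lt hab
  constructor
  · have h := MZV.head?_of_mem_shuffleWord _ _ he
    simp only [List.head?_eq_getElem?, List.getElem?_ofFn, ha, hb, hab, dif_pos,
      Option.some.injEq] at h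
    dsimp only
    rcases h with h | h
    · rw [h, Fin.append_left]
      exact (hε ha).1
    · rw [h, Fin.append_right]
      exact (hε' hb).1
  · have h := MZV.getLast?_of_mem_shuffleWord _ _ he
    simp only [List.getLast?_eq_getElem?, List.length_ofFn, List.getElem?_ofFn, ha1, hb1, hab1,
      dif_pos, Option.some.injEq] at h
    dsimp only
    rcases h with h | h
    · rw [h, Fin.append_left]
      exact (hε ha).2
    · rw [h, Fin.append_right]
      exact (hε' hb).2

end Coord

end Summit.KontsevichZagierPeriods.MzvKernelInKZ.TwoPosets
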